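import Literature.Geometry.Lorentzian.KerrDecayHierarchy
import HarnessLib

/-!
# Calibration of the vendored `r^p` hierarchy on Kerr against the flux decay it serves

(statement group **gr.S24**; namespace `Literature.Geometry.Lorentzian.Kerr`)

`KerrDecayHierarchy.lean` decomposes the first estimate of Dafermos–Rodnianski–Shlapentokh-Rothman,
*Decay for solutions of the wave equation on Kerr exterior spacetimes III*, arXiv:1402.7034 =
Ann. of Math. 183 (2016) ("DRSR"), Cor. 3.1, for the hyperboloidal foliation `Σ̃_τ(h♯_{R₁})`
(named fact `Kerr.drsr_corollary_3_1_scri_flux_decay` of `KerrHyperboloidalFlux.lean`) into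
fact A (`Kerr.drsr_theorems_3_1_3_2_scri`: DRSR Thms. 3.1–3.2 in §3.3 form) and fact B
(`Kerr.dafermosRodnianski_pHierarchy_scri`: the `p = 1, 2` members of the Dafermos–Rodnianski
`r^p` hierarchy in the far region, arXiv:0910.4957, §3–§4; Moschidis, arXiv:1509.08489, Thm. 5.1),
the `p = 1` weighted energy being kept abstract in B (an existentially quantified `q : ℝ → ℝ≥0∞`),
and proves `A ∧ B ⟹ Cor. 3.1` (`Kerr.drsr_corollary_3_1_scri_flux_decay_of_hierarchy`).

This file records the converse direction of that bookkeeping, which needs no analysis: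

* `Kerr.dafermosRodnianski_pHierarchy_scri_of_corollary_3_1_scri` (**proved**):
  `Kerr.drsr_corollary_3_1_scri_flux_decay → Kerr.dafermosRodnianski_pHierarchy_scri`. Given
  `F(τ) ≤ C_ψ τ⁻²` for `τ ≥ 1` (`F` the `V`-flux through `Σ̃_τ(h♯_{R₁})`), the choices
  `q(s) = C_ψ s⁻¹`, `D = C_ψ`, `C = 1` (any error radius `R'`) satisfy (B1)–(B4) of fact B:
  `q` is non-increasing, `∫_{[s,2s]} F ≤ s · C_ψ s⁻² = q(s)`, `∫_{[s,2s]} C_ψ τ⁻¹ dτ ≤ C_ψ = D`,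
  `q(1) = D`; all error and flux terms on the right-hand sides are simply dropped.
* `Kerr.dafermosRodnianski_pHierarchy_scri_iff_corollary_3_1_scri` (**proved**): under fact A,
  fact B is *equivalent* to Cor. 3.1 in flux form.

So the existential weakening in fact B retains, of the printed far-region estimates, exactly
their consequence for the decay rate: fact B is not a soft statement (no choice of `q` avoids
proving `τ⁻²`-type decay of the energy flux through the hyperboloidal leaves of every admissible
wave), and it asserts nothing beyond Cor. 3.1 once Theorems 3.1–3.2 are granted. In particular a
discharge of `Kerr.drsr_corollary_3_1_scri_flux_decay` by any route discharges fact B. Nothing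
here bears on the truth of either fact; both remain named facts (D-0014).

## References

* M. Dafermos, I. Rodnianski, Y. Shlapentokh-Rothman, arXiv:1402.7034 = Ann. of Math. 183 (2016),
  §3.3, Cor. 3.1 (key `DafermosRodnianskiShlapentokhrothman2014`).
* M. Dafermos, I. Rodnianski, *A new physical-space approach to decay for the wave equation with
  applications to black hole spacetimes*, arXiv:0910.4957, §4 (the dyadic iteration: decay
  `τ⁻²` from the `p = 1, 2` hierarchy, boundedness and integrated decay)
  (key `DafermosRodnianski2010ICMP`).
* G. Moschidis, arXiv:1509.08489 = Ann. PDE 2 (2016), Thm. 5.1 (key `Moschidis2016`).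
-/

noncomputable section

open Set MeasureTheory
open scoped ENNReal

namespace Literature.Geometry.Lorentzian

namespace Kerr

/-- **Fact B is implied by Corollary 3.1 in flux form.** The vendored (existentially weakened)
form `Kerr.dafermosRodnianski_pHierarchy_scri` of the `p = 1, 2` members of the
Dafermos–Rodnianski hierarchy follows from the flux-decay statement
`Kerr.drsr_corollary_3_1_scri_flux_decay` which it serves to prove
(`Kerr.drsr_corollary_3_1_scri_flux_decay_of_hierarchy`): given `F(τ) ≤ C_ψ τ⁻²` for `τ ≥ 1`,
take `q(s) = C_ψ s⁻¹`, `D = C_ψ`, `C = 1`, `R' = 0`; then (B1) holds because `q` is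
non-increasing on `[1, ∞)`, (B2) because `∫_{[s,2s]} F(τ) dτ ≤ s · C_ψ s⁻² = q(s)`, (B3) because
`∫_{[s,2s]} C_ψ τ⁻¹ dτ ≤ s · C_ψ s⁻¹ = D`, and (B4) because `q(1) = C_ψ`. Logical bookkeeping
for the decomposition of DRSR, arXiv:1402.7034, §3.3 (the dyadic scheme of arXiv:0910.4957, §4,
read backwards); no analytic input. [cite: DafermosRodnianskiShlapentokhrothman2014, §3.3 Cor. 3.1] -/
theorem dafermosRodnianski_pHierarchy_scri_of_corollary_3_1_scri
    (h : drsr_corollary_3_1_scri_flux_decay) : dafermosRodnianski_pHierarchy_scri := by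
  intro _ _ M a hMa
  obtain ⟨R₀, hR₀, h⟩ := h M a hMa
  refine ⟨R₀, hR₀, fun R₁ hR₁ ↦ ⟨1, 0, ENNReal.one_lt_top, fun ψ hψ hball ↦ ?_⟩⟩
  obtain ⟨Cψ, hCψ, hdec⟩ := h R₁ hR₁ ψ hψ hball
  -- `q(s) = C_ψ s⁻¹`, `D = C_ψ`
  refine ⟨fun s ↦ Cψ * ENNReal.ofReal s⁻¹, Cψ, hCψ, ?_, ?_, ?_, ?_⟩
  · -- (B1): `q` is non-increasing on `[1, ∞)`
    intro s t hs hst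
    beta_reduce
    rw [one_mul]
    have hs0 : 0 < s := by linarith
    exact le_add_right (le_add_right (le_add_right
      (mul_le_mul' le_rfl (ENNReal.ofReal_le_ofReal (inv_anti₀ hs0 hst)))))
  · -- (B2): `∫_{[s,2s]} F ≤ ∫_{[s,2s]} C_ψ τ⁻² ≤ s · C_ψ s⁻² = q(s)`
    intro s hs
    beta_reduce
    rw [one_mul]
    have hs0 : 0 < s := by linarith
    have hs1 : s ≠ 0 := hs0.ne'
    have h2 : s ^ (-2 : ℝ) * (2 * s - s) = s⁻¹ := by
      rw [Real.rpow_neg hs0.le, Real.rpow_two]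
      field_simp
      ring
    calc ∫⁻ τ in Icc s (2 * s), leafFlux M a (scriHeight M a R₁) ψ τ
        ≤ ∫⁻ _ in Icc s (2 * s), Cψ * ENNReal.ofReal (s ^ (-2 : ℝ)) := by
          refine setLIntegral_mono' measurableSet_Icc fun τ hτ ↦ ?_
          calc leafFlux M a (scriHeight M a R₁) ψ τ
              ≤ Cψ * ENNReal.ofReal (τ ^ (-2 : ℝ)) := hdec τ (hs.trans hτ.1)
            _ ≤ Cψ * ENNReal.ofReal (s ^ (-2 : ℝ)) :=
                mul_le_mul' le_rfl (ENNReal.ofReal_le_ofReal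
                  (Real.rpow_le_rpow_of_nonpos hs0 hτ.1 (by norm_num)))
      _ = Cψ * ENNReal.ofReal (s ^ (-2 : ℝ)) * volume (Icc s (2 * s)) := setLIntegral_const _ _
      _ = Cψ * ENNReal.ofReal s⁻¹ := by
          rw [Real.volume_Icc, mul_assoc, ← ENNReal.ofReal_mul (Real.rpow_nonneg hs0.le _), h2]
      _ ≤ Cψ * ENNReal.ofReal s⁻¹ + leafFlux M a (scriHeight M a R₁) ψ s +
            leafFlux M a (scriHeight M a R₁) ψ (2 * s) +
            localError M a (scriHeight M a R₁) ψ 0 s (2 * s) :=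
          le_add_right (le_add_right le_self_add)
  · -- (B3): `∫_{[s,2s]} C_ψ τ⁻¹ dτ ≤ s · C_ψ s⁻¹ = C_ψ = D`
    intro s hs
    beta_reduce
    have hs0 : 0 < s := by linarith
    have hs1 : s ≠ 0 := hs0.ne'
    have h1 : s⁻¹ * (2 * s - s) = 1 := by
      field_simp
      ring
    calc ∫⁻ τ in Icc s (2 * s), Cψ * ENNReal.ofReal τ⁻¹
        ≤ ∫⁻ _ in Icc s (2 * s), Cψ * ENNReal.ofReal s⁻¹ :=
          setLIntegral_mono' measurableSet_Icc fun τ hτ ↦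
            mul_le_mul' le_rfl (ENNReal.ofReal_le_ofReal (inv_anti₀ hs0 hτ.1))
      _ = Cψ * ENNReal.ofReal s⁻¹ * volume (Icc s (2 * s)) := setLIntegral_const _ _
      _ = Cψ := by
          rw [Real.volume_Icc, mul_assoc, ← ENNReal.ofReal_mul (inv_nonneg.2 hs0.le), h1,
            ENNReal.ofReal_one, mul_one]
      _ ≤ Cψ + 1 * (leafFlux M a (scriHeight M a R₁) ψ (2 * s) +
            localError M a (scriHeight M a R₁) ψ 0 1 (2 * s)) := le_self_add
  · -- (B4): `q(1) = C_ψ`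
    simp

/-- **Under Theorems 3.1–3.2, fact B is equivalent to Corollary 3.1 in flux form**:
`Kerr.drsr_theorems_3_1_3_2_scri → (Kerr.dafermosRodnianski_pHierarchy_scri ↔
Kerr.drsr_corollary_3_1_scri_flux_decay)` — the assembly
`Kerr.drsr_corollary_3_1_scri_flux_decay_of_hierarchy` one way,
`Kerr.dafermosRodnianski_pHierarchy_scri_of_corollary_3_1_scri` the other. DRSR arXiv:1402.7034,
§3.3. [cite: DafermosRodnianskiShlapentokhrothman2014, §3.3 Cor. 3.1] -/
theorem dafermosRodnianski_pHierarchy_scri_iff_corollary_3_1_scri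
    (hA : drsr_theorems_3_1_3_2_scri) :
    dafermosRodnianski_pHierarchy_scri ↔ drsr_corollary_3_1_scri_flux_decay :=
  ⟨drsr_corollary_3_1_scri_flux_decay_of_hierarchy hA,
    dafermosRodnianski_pHierarchy_scri_of_corollary_3_1_scri⟩

end Kerr

end Literature.Geometry.Lorentzian

end
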